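import Summits.KontsevichZagierPeriods.KontsevichZagierPeriods.Theorems.HurwitzMicroSectorsNormalFormPrincipleLevelOne
import Summits.KontsevichZagierPeriods.KontsevichZagierPeriods.Theorems.HurwitzMicroSectorsNormalFormPrincipleSlabASubPtK20
import Summits.KontsevichZagierPeriods.KontsevichZagierPeriods.Theorems.HurwitzMicroSectorsNormalFormPrincipleAlgCarriers
import Summits.KontsevichZagierPeriods.KontsevichZagierPeriods.Theorems.HurwitzMicroSectorsNormalFormPrincipleM2FiveZetaTwo
import Summits.KontsevichZagierPeriods.KontsevichZagierPeriods.Theorems.AperySectorThreeTwo.Negative.Kit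
import Summits.KontsevichZagierPeriods.KontsevichZagierPeriods.Theorems.HurwitzMicroSectorsNormalFormPrincipleLevelKPowerSubstitution

/-!
# `NormalFormPrinciple` (stmt-KontsevichZagierPeriods-3869), line `SketchIdeator1` — leaf `stub_boxRigidity`:
# weight three, level `K`, totally off resonance: the power substitution `(X,Y,Z) ↦ (X^{m₁}, Y^{m₂}, Z^{m₃})` (rule 2)

Pure proof file (`--supports` the crux). Registered sub-goal `power_substitution3` of the layer
"Conjecture 1 for the boxes `[(0,1)³, c x^a y^b z^d/(1 − x^{k₁} y^{k₂} z^{k₃})]` totally off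
resonance" (lead file `…Weight3`): the box `[(0,1)³, c x^a y^b z^d/(1 − x^{k₁} y^{k₂} z^{k₃})]` is
the push-forward, by ONE change of variables, of
`[(0,1)³, c m₁m₂m₃ X^{(a+1)m₁−1} Y^{(b+1)m₂−1} Z^{(d+1)m₃−1}/(1 − X^{k₁m₁} Y^{k₂m₂} Z^{k₃m₃})]`
(`m₁, m₂, m₃ ≥ 1`).

The chart `Φ(X,Y,Z) = (X^{m₁}, Y^{m₂}, Z^{m₃})` is the coordinatewise power chart of the open unit
box onto itself (`LevelK.lk_exists_coordPowChart`, valid in every dimension: `ℚ`-semialgebraic,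
differentiable with `|det DΦ| = m₁m₂m₃ X^{m₁−1} Y^{m₂−1} Z^{m₃−1}`, injective on the box and onto
it). The pull-back identity
`c (X^{m₁})^a (Y^{m₂})^b (Z^{m₃})^d/(1 − (X^{m₁})^{k₁} (Y^{m₂})^{k₂} (Z^{m₃})^{k₃}) · |det DΦ|
  = c m₁m₂m₃ X^{(a+1)m₁−1} Y^{(b+1)m₂−1} Z^{(d+1)m₃−1}/(1 − X^{k₁m₁} Y^{k₂m₂} Z^{k₃m₃})`
holds identically (`w3_pow_pullback`; `(a+1)m − 1 = a m + (m − 1)` is a genuine natural number as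
`m ≥ 1`). Hence `[N'] − [N] ∈ KZ.changeOfVariablesRel ⊆ KZ.relations` (source = the pull-back
`N'`, image = `N`), and `[N] − [N']` is its negative. Rule (2) asks for the integrand identity on
the domain only, so the `EqOn` hypotheses suffice; the algebraicity of `c` and the positivity of
`k₁, k₂, k₃` are not used (both representations being given).

References: M. Kontsevich, D. Zagier, *Periods* (2001), §1.2 rule (2). No new definitions.
-/

noncomputable section

open MeasureTheory Set
open Literature.NumberTheory.Transcendental Literature.NumberTheory.Transcendental.KZ
open Literature.ModelTheory.ExponentialFields (IsSemialgebraic)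

namespace Summit.KontsevichZagierPeriods.HurwitzMicroSectors.NormalFormPrinciple.PiBox.Weight3

/-- **The pull-back identity** of the power chart `(X,Y,Z) ↦ (X^{m₁}, Y^{m₂}, Z^{m₃})` (Jacobian
`m₁m₂m₃ X^{m₁−1} Y^{m₂−1} Z^{m₃−1}` included), `m₁, m₂, m₃ ≥ 1`:
`c m₁m₂m₃ X^{(a+1)m₁−1} Y^{(b+1)m₂−1} Z^{(d+1)m₃−1}/(1 − X^{k₁m₁} Y^{k₂m₂} Z^{k₃m₃})
  = c (X^{m₁})^a (Y^{m₂})^b (Z^{m₃})^d/(1 − (X^{m₁})^{k₁} (Y^{m₂})^{k₂} (Z^{m₃})^{k₃})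
      · (m₁ X^{m₁−1} · (m₂ Y^{m₂−1}) · (m₃ Z^{m₃−1}))`,
identically in `X, Y, Z`. [folklore] -/
theorem w3_pow_pullback (c : ℝ) (a b d : ℕ) {m₁ m₂ m₃ : ℕ} (hm₁ : 0 < m₁) (hm₂ : 0 < m₂)
    (hm₃ : 0 < m₃) (k₁ k₂ k₃ : ℕ) (x y z : ℝ) :
    c * ((m₁ * m₂ * m₃ : ℕ) : ℝ) *
        (x ^ ((a + 1) * m₁ - 1) * y ^ ((b + 1) * m₂ - 1) * z ^ ((d + 1) * m₃ - 1)) /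
        (1 - x ^ (k₁ * m₁) * y ^ (k₂ * m₂) * z ^ (k₃ * m₃)) =
      c * ((x ^ m₁) ^ a * (y ^ m₂) ^ b * (z ^ m₃) ^ d) /
          (1 - (x ^ m₁) ^ k₁ * (y ^ m₂) ^ k₂ * (z ^ m₃) ^ k₃) *
        ((m₁ : ℝ) * x ^ (m₁ - 1) * ((m₂ : ℝ) * y ^ (m₂ - 1)) * ((m₃ : ℝ) * z ^ (m₃ - 1))) := by
  have e₁ : (a + 1) * m₁ - 1 = a * m₁ + (m₁ - 1) := by rw [add_one_mul]; omega
  have e₂ : (b + 1) * m₂ - 1 = b * m₂ + (m₂ - 1) := by rw [add_one_mul]; omega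
  have e₃ : (d + 1) * m₃ - 1 = d * m₃ + (m₃ - 1) := by rw [add_one_mul]; omega
  rw [e₁, e₂, e₃]
  push_cast
  ring

/-- **Stub W1 (the power substitution `(X,Y,Z) ↦ (X^{m₁}, Y^{m₂}, Z^{m₃})`, rule 2):**
`[(0,1)³, c x^a y^b z^d/(1 − x^{k₁}y^{k₂}z^{k₃})]` is the push-forward of
`[(0,1)³, c m₁m₂m₃ X^{(a+1)m₁−1} Y^{(b+1)m₂−1} Z^{(d+1)m₃−1}/(1 − X^{k₁m₁} Y^{k₂m₂} Z^{k₃m₃})]`.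
One raw change-of-variables move `KZ.changeOfVariablesRel` with source the pull-back `N'`, chart
`Φ(X,Y,Z) = (X^{m₁}, Y^{m₂}, Z^{m₃})` (`LevelK.lk_exists_coordPowChart` with exponent vector
`(m₁, m₂, m₃)`) and image `N`: the identity `N'.integrand = (N.integrand ∘ Φ) · |det DΦ|` on the
box is `w3_pow_pullback`; then `[N] − [N'] = −([N'] − [N])`. (The hypotheses that `c` is
algebraic and `k₁, k₂, k₃ ≥ 1` are not needed: both representations are given.)
[cite: KontsevichZagier2001, §1.2 rule (2)] -/
theorem power_substitution3 (m₁ m₂ m₃ : ℕ) (hm₁ : 0 < m₁) (hm₂ : 0 < m₂) (hm₃ : 0 < m₃)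
    (k₁ k₂ k₃ : ℕ) (hk₁ : 0 < k₁) (hk₂ : 0 < k₂) (hk₃ : 0 < k₃) (c : ℝ) (hc : IsAlgebraic ℚ c)
    (a b d : ℕ) (N N' : IntegralRep 3)
    (hNd : N.domain = {x | ∀ i, x i ∈ Set.Ioo (0:ℝ) 1})
    (hNi : EqOn N.integrand (fun x => c * (x 0 ^ a * x 1 ^ b * x 2 ^ d) /
      (1 - x 0 ^ k₁ * x 1 ^ k₂ * x 2 ^ k₃)) N.domain)
    (hN'd : N'.domain = {x | ∀ i, x i ∈ Set.Ioo (0:ℝ) 1})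
    (hN'i : EqOn N'.integrand (fun x => c * ((m₁ * m₂ * m₃ : ℕ) : ℝ) *
      (x 0 ^ ((a + 1) * m₁ - 1) * x 1 ^ ((b + 1) * m₂ - 1) * x 2 ^ ((d + 1) * m₃ - 1)) /
      (1 - x 0 ^ (k₁ * m₁) * x 1 ^ (k₂ * m₂) * x 2 ^ (k₃ * m₃))) N'.domain) :
    of N - of N' ∈ relations := by
  -- `hc`, `hk₁`, `hk₂`, `hk₃` are not needed (both representations are given); record and drop them
  have _ : IsAlgebraic ℚ c := hc
  have _ : 0 < k₁ := hk₁
  have _ : 0 < k₂ := hk₂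
  have _ : 0 < k₃ := hk₃
  clear hc hk₁ hk₂ hk₃
  have hm : ∀ i, (![m₁, m₂, m₃] : Fin 3 → ℕ) i ≠ 0 := by
    intro i
    fin_cases i
    · exact hm₁.ne'
    · exact hm₂.ne'
    · exact hm₃.ne'
  obtain ⟨Φ, Φ', hΦ, hsa, hderiv, hinj, himage, hdet⟩ :=
    LevelK.lk_exists_coordPowChart ![m₁, m₂, m₃] hm
  have himage' : N.domain = Φ '' N'.domain := by rw [hN'd, himage, hNd]
  have hsa' : IsSemialgebraicMapOn ℚ N'.domain Φ := by rw [hN'd]; exact hsa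
  have hinj' : InjOn Φ N'.domain := by rw [hN'd]; exact hinj
  -- the raw rule-(2) witness: source the pull-back `N'`, image `N`
  have h : of N' - of N ∈ relations := by
    refine changeOfVariablesRel_subset_relations
      ⟨3, N', N, Φ, Φ', hsa', fun x _ => (hderiv x).hasFDerivWithinAt, hinj', himage',
        fun x hx => ?_, rfl⟩
    -- the pull-back identity on `N'.domain`,
    -- Jacobian `|det DΦ| = m₁ x₀^{m₁-1} · m₂ x₁^{m₂-1} · m₃ x₂^{m₃-1}`
    have hΦx : Φ x ∈ N.domain := himage' ▸ mem_image_of_mem _ hx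
    have hx' : x ∈ {x : Fin 3 → ℝ | ∀ i, x i ∈ Set.Ioo (0:ℝ) 1} := hN'd ▸ hx
    rw [hN'i hx, hNi hΦx, hdet x hx']
    simp only [hΦ, Fin.prod_univ_three, Matrix.cons_val_zero, Matrix.cons_val_one,
      Matrix.cons_val_two, Matrix.tail_cons, Matrix.head_cons]
    exact w3_pow_pullback c a b d hm₁ hm₂ hm₃ k₁ k₂ k₃ (x 0) (x 1) (x 2)
  simpa only [neg_sub] using relations.neg_mem h

end Summit.KontsevichZagierPeriods.HurwitzMicroSectors.NormalFormPrinciple.PiBox.Weight3
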